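import Literature.NumberTheory.Kottwitz1992.Involutions
import Mathlib.RingTheory.SimpleModule.WedderburnArtin
import Mathlib.LinearAlgebra.PID
import HarnessLib

/-!
# [Kottwitz1992, Lemma 2.4 p. 380] A positive involution respects the simple factors — DISCHARGED:
# `Kottwitz1992_2_4_product_of_simple_holds`

Kernel-lane companion of the statement carpet ★ `Literature/NumberTheory/Kottwitz1992/Involutions.lean` (squad TK): the named fact ★
`Involutions.Kottwitz1992_2_4_product_of_simple` — «Let `*` be a positive involution of `B`.  Then `*` leaves stable each simple factor of
`B`, and as an algebra with involution `B` is the direct product of simple algebras with positive involution» — is PROVED here.  THEOREMS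
ONLY (no definition, no named fact, no `sorry`, no instance, no notation); cell hodgecm-mathlib, seat B-typ02 (g31); net debt −1.

R. E. Kottwitz, *Points on some Shimura varieties over finite fields*, J. Amer. Math. Soc. 5 (1992), Lemma 2.4 p. 380, proof p. 380 L28–L31
(held `paper:doi-10-2307-2152772`, p0008 L25–L31).  THE PRINTED PROOF: «Obviously the involution permutes the simple factors of `B`.  It
cannot interchange two factors; if it did, then `xx*` would be zero for any element `x` belonging to one of these factors, which would
contradict (3) in Lemma 2.2.  Therefore the involution preserves the simple factors and is positive on them by (3) of Lemma 2.3.»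
Formalised: (first clause, §1) for a minimal two-sided ideal `I` and `x ∈ I` with `x* ∉ I`, the two-sided ideal `I' = {y | y* ∈ I}` meets
`I` trivially (minimality), yet `xx* ∈ I ∩ I'` (`(xx*)* = xx*`), so `xx* = 0`, contradicting `tr_{B/ℝ}(xx*) > 0`; (second clause, §2–§3)
the simple factors are produced by Mathlib's Wedderburn–Artin theorem (`IsSemisimpleRing.exists_algEquiv_pi_matrix_divisionRing_finite`:
`B ≅ ∏ᵢ M_{dᵢ}(Dᵢ)`), whose unit idempotents `εᵢ` are central; `εᵢ*` is again a central idempotent, i.e. a `0/1`-vector of factors (a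
central idempotent of a simple ring is `0` or `1`, §2), containing the factor `i` because `εᵢ εᵢ* ≠ 0` (positivity) and no other factor
because `εᵢ* εⱼ* = (εⱼ εᵢ)* = 0` — so `εᵢ* = εᵢ` («it cannot interchange two factors»), the involution descends to each factor
(`κᵢ(c) = (e (e⁻¹(c at i))*)ᵢ`), and it is positive there because `tr_{Cᵢ/ℝ}(c κᵢ c) = tr_{B/ℝ}(x x*)` for `x = e⁻¹(c at i)` (the trace of
left multiplication by an element of the factor `εᵢ B` is computed on that factor).
HONEST LABEL: HC_CM is proved only modulo the 7 printed citations (2 remaining: hLiu418, h413) until rung 0 closes; this file adds no citation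
debt (0 facts, 0 sorry) and discharges 1 named fact of ★ `Involutions`.

## References
* [Kottwitz1992] R. E. Kottwitz, Points on some Shimura varieties over finite fields, J. Amer. Math. Soc. 5 (1992) 373–444, Lemma 2.4 p. 380.
-/

namespace Literature.NumberTheory.Kottwitz1992.Involutions

open Literature.NumberTheory.Automorphic (leftMulTrace leftMulTrace_apply)

universe u

variable {B : Type u} [Ring B] [Algebra ℝ B] (ι : B →ₗ[ℝ] B)

/-! ## §1 First clause: `*` leaves stable each minimal two-sided ideal -/

/-- **«`*` leaves stable each simple factor of `B`»** (p. 380 L25–L26, proof L28–L30): for a minimal two-sided ideal `I` and `x ∈ I`, if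
`x* ∉ I` then the two-sided ideal `I' = {y | y* ∈ I}` meets `I` in `0` (minimality of `I`), while `xx* ∈ I ∩ I'` since `(xx*)* = xx*`; so
`xx* = 0`, «which would contradict (3) in Lemma 2.2». [cite: Kottwitz1992, Lemma 2.4 (p. 380)] -/
private theorem apply_mem_of_isAtom (hP : IsPositiveInvolution B ι) (I : TwoSidedIdeal B) (hI : IsAtom I)
    (x : B) (hx : x ∈ I) : ι x ∈ I := by
  have hIι : IsInvolution ℝ B ι := hP.toIsInvolution
  by_contra hxI
  let I' : TwoSidedIdeal B := TwoSidedIdeal.mk' {y | ι y ∈ I} (by simp [I.zero_mem])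
    (fun {y z} hy hz => by simp only [Set.mem_setOf_eq, map_add]; exact I.add_mem hy hz)
    (fun {y} hy => by simp only [Set.mem_setOf_eq, map_neg]; exact I.neg_mem hy)
    (fun {y z} hz => by simp only [Set.mem_setOf_eq, hIι.map_mul]; exact I.mul_mem_right _ _ hz)
    (fun {y z} hy => by simp only [Set.mem_setOf_eq, hIι.map_mul]; exact I.mul_mem_left _ _ hy)
  have hmem : ∀ y, y ∈ I' ↔ ι y ∈ I := fun y => TwoSidedIdeal.mem_mk' _ _ _ _ _ _ y
  have hinf : I ⊓ I' = ⊥ := by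
    rcases eq_or_ne (I ⊓ I') ⊥ with h | h
    · exact h
    · exfalso
      have hle : I ⊓ I' = I := ((hI.le_iff.1 inf_le_left).resolve_left h)
      have hII' : I ≤ I' := hle ▸ inf_le_right
      exact hxI ((hmem x).1 (hII' hx))
  have hne : x ≠ 0 := fun h0 => hxI (by rw [h0, map_zero]; exact I.zero_mem)
  have hfix : x * ι x ∈ I ⊓ I' :=
    (TwoSidedIdeal.mem_inf B).2 ⟨I.mul_mem_right _ _ hx,
      (hmem _).2 (by rw [hIι.map_mul, hIι.apply_apply]; exact I.mul_mem_right _ _ hx)⟩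
  rw [hinf, TwoSidedIdeal.mem_bot] at hfix
  have := hP.trace_mul_self_pos x hne
  rw [hfix, map_zero] at this
  exact lt_irrefl _ this

/-! ## §2 A central idempotent of a simple ring is `0` or `1` -/

omit ι in
/-- In a simple ring a central idempotent `c` is `0` or `1`: the two-sided ideal `cA` is `0` or `A`. (Used for «the involution permutes the
simple factors»: a central idempotent of `∏ᵢ Cᵢ` is a `0/1`-vector.) [cite: Kottwitz1992, Lemma 2.4 (p. 380)] -/
private theorem eq_zero_or_eq_one_of_central_idempotent {A : Type u} [Ring A] [IsSimpleRing A] (c : A)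
    (hc : ∀ a : A, c * a = a * c) (h2 : c * c = c) : c = 0 ∨ c = 1 := by
  let J : TwoSidedIdeal A := TwoSidedIdeal.mk' {a | ∃ b, a = c * b} ⟨0, by rw [mul_zero]⟩
    (fun {x y} hx hy => by
      obtain ⟨bx, hx⟩ := hx
      obtain ⟨by', hy⟩ := hy
      exact ⟨bx + by', by rw [hx, hy, mul_add]⟩)
    (fun {x} hx => by
      obtain ⟨bx, hx⟩ := hx
      exact ⟨-bx, by rw [hx, mul_neg]⟩)
    (fun {x y} hy => by
      obtain ⟨b, hy⟩ := hy
      exact ⟨x * b, by rw [hy, ← mul_assoc, ← hc x, mul_assoc]⟩)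
    (fun {x y} hx => by
      obtain ⟨b, hx⟩ := hx
      exact ⟨b * y, by rw [hx, mul_assoc]⟩)
  have hmem : ∀ a, a ∈ J ↔ ∃ b, a = c * b := fun a => TwoSidedIdeal.mem_mk' _ _ _ _ _ _ a
  rcases IsSimpleOrder.eq_bot_or_eq_top J with h | h
  · left
    have hcJ : c ∈ J := (hmem c).2 ⟨1, (mul_one c).symm⟩
    rw [h] at hcJ
    exact (TwoSidedIdeal.mem_bot A).1 hcJ
  · right
    have h1 : (1 : A) ∈ J := by rw [h]; simp
    obtain ⟨b, hb⟩ := (hmem 1).1 h1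
    calc c = c * 1 := (mul_one c).symm
      _ = c * (c * b) := by rw [← hb]
      _ = 1 := by rw [← mul_assoc, h2, ← hb]

/-! ## §3 The discharge -/

/-- **LEMMA 2.4, PROVED**: ★ `Kottwitz1992_2_4_product_of_simple` holds — `*` leaves stable every minimal two-sided ideal (§1), and with
Wedderburn–Artin `e : B ≅ ∏ᵢ M_{dᵢ}(Dᵢ)` the involution fixes the unit idempotents `εᵢ` of the factors (`εᵢ*` is a central idempotent, a
`0/1`-vector of factors containing `i` by positivity and no `j ≠ i` since `εᵢ* εⱼ* = (εⱼ εᵢ)* = 0`), hence induces on each simple factor the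
involution `κᵢ(c) = (e (e⁻¹(c at i))*)ᵢ`, positive because `tr_{Cᵢ/ℝ}(c κᵢ c) = tr_{B/ℝ}(x x*) > 0` for `x = e⁻¹(c at i)`.
[cite: Kottwitz1992, Lemma 2.4 (p. 380)] -/
theorem Kottwitz1992_2_4_product_of_simple_holds : Kottwitz1992_2_4_product_of_simple B ι := by
  intro hA hP
  refine ⟨fun I hI x hx => apply_mem_of_isAtom ι hP I hI x hx, ?_⟩
  classical
  haveI := hA.finiteDimensional
  haveI := hA.isSemisimpleRing
  have hI : IsInvolution ℝ B ι := hP.toIsInvolution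
  obtain ⟨n, D, d, _instD, _instA, _instF, hd, ⟨e⟩⟩ :=
    IsSemisimpleRing.exists_algEquiv_pi_matrix_divisionRing_finite ℝ B
  have hnt : ∀ i, Nontrivial (Matrix (Fin (d i)) (Fin (d i)) (D i)) := fun i => by
    haveI := hd i
    infer_instance
  -- the unit vectors `uᵢ = (1 at i)`; products with them pick components
  let u : Fin n → ∀ j, Matrix (Fin (d j)) (Fin (d j)) (D j) := fun i => Pi.single i 1
  have hu1 : ∀ i, u i i = 1 := fun i => Pi.single_eq_same _ _
  have hu0 : ∀ i j, j ≠ i → u i j = 0 := fun i j h => Pi.single_eq_of_ne h _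
  have hmulε : ∀ (w : ∀ j, Matrix (Fin (d j)) (Fin (d j)) (D j)) (i j : Fin n),
      (w * u i) j = if j = i then w j else 0 := by
    intro w i j
    rw [Pi.mul_apply]
    by_cases h : j = i
    · subst h; rw [hu1, mul_one, if_pos rfl]
    · rw [hu0 i j h, mul_zero, if_neg h]
  have hεmul : ∀ (w : ∀ j, Matrix (Fin (d j)) (Fin (d j)) (D j)) (i j : Fin n),
      (u i * w) j = if j = i then w j else 0 := by
    intro w i j
    rw [Pi.mul_apply]
    by_cases h : j = i
    · subst h; rw [hu1, one_mul, if_pos rfl]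
    · rw [hu0 i j h, zero_mul, if_neg h]
  -- the central idempotents `εᵢ = e⁻¹(1 at i)`
  let ε : Fin n → B := fun i => e.symm (u i)
  have heε : ∀ i, e (ε i) = u i := fun i => e.apply_symm_apply _
  have hεcomm : ∀ (i) (b : B), ε i * b = b * ε i := fun i b => e.injective (by
    rw [map_mul, map_mul, heε]
    funext j
    rw [hεmul, hmulε])
  have hεε : ∀ i, ε i * ε i = ε i := fun i => e.injective (by
    rw [map_mul, heε]
    funext j
    rw [hmulε]
    split_ifs with h
    · rfl
    · exact (hu0 i j h).symm)
  have hεorth : ∀ i j, i ≠ j → ε i * ε j = 0 := fun i j hij => e.injective (by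
    rw [map_mul, heε, heε, map_zero]
    funext k
    rw [hεmul, Pi.zero_apply]
    split_ifs with h
    · rw [h]; exact hu0 j i hij
    · rfl)
  have hεne : ∀ i, ε i ≠ 0 := fun i h0 => by
    haveI := hnt i
    have h := congrArg (fun y => e y i) h0
    simp only [heε, hu1, map_zero, Pi.zero_apply] at h
    exact one_ne_zero h
  -- `εᵢ*` is a central idempotent: its components are `0` or `1`
  have hz : ∀ (i) (b : B), ι (ε i) * b = b * ι (ε i) := fun i b => by
    conv_lhs => rw [← hI.apply_apply b]
    rw [← hI.map_mul, ← hεcomm, hI.map_mul, hI.apply_apply]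
  have h01 : ∀ i j, e (ι (ε i)) j = 0 ∨ e (ι (ε i)) j = 1 := fun i j => by
    haveI := hd j
    refine eq_zero_or_eq_one_of_central_idempotent _ (fun a => ?_) ?_
    · have h := congrArg (fun y => e y j) (hz i (e.symm (Pi.single j a)))
      simpa [Pi.mul_apply] using h
    · have h := congrArg (fun y => e y j) (show ι (ε i) * ι (ε i) = ι (ε i) by rw [← hI.map_mul, hεε])
      simpa [Pi.mul_apply] using h
  -- the factor `i` belongs to the support of `εᵢ*` (positivity) …
  have hdiag : ∀ i, e (ι (ε i)) i = 1 := fun i => by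
    rcases h01 i i with h | h
    · exfalso
      have hzero : ε i * ι (ε i) = 0 := e.injective (by
        rw [map_mul, heε, map_zero]
        funext k
        rw [hεmul, Pi.zero_apply]
        split_ifs with hk
        · rw [hk, h]
        · rfl)
      have := hP.trace_mul_self_pos (ε i) (hεne i)
      rw [hzero, map_zero] at this
      exact lt_irrefl _ this
    · exact h
  -- … and no other factor does: «it cannot interchange two factors»
  have hoff : ∀ i k, k ≠ i → e (ι (ε i)) k = 0 := fun i k hki => by
    rcases h01 i k with h | h
    · exact h
    · exfalso
      have hzero : ι (ε i) * ι (ε k) = 0 := by rw [← hI.map_mul, hεorth k i hki, map_zero]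
      have h' := congrArg (fun y => e y k) hzero
      haveI := hnt k
      simp only [map_mul, Pi.mul_apply, h, hdiag k, mul_one, map_zero, Pi.zero_apply] at h'
      exact one_ne_zero h'
  have hιε : ∀ i, ι (ε i) = ε i := fun i => e.injective (by
    rw [heε]
    funext k
    by_cases hk : k = i
    · subst hk; rw [hdiag, hu1]
    · rw [hoff i k hk, hu0 i k hk])
  -- the factors `fᵢ : Cᵢ → B`, `fᵢ(c) = e⁻¹(c at i)`, and the induced involutions `κᵢ`
  let f : ∀ i, Matrix (Fin (d i)) (Fin (d i)) (D i) → B := fun i c => e.symm (Pi.single i c)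
  have hef : ∀ i c, e (f i c) = Pi.single i c := fun i c => e.apply_symm_apply _
  have hfmul : ∀ i c c', f i (c * c') = f i c * f i c' := fun i c c' => by
    show e.symm _ = e.symm _ * e.symm _
    rw [← map_mul, Pi.single_mul]
  have hεf : ∀ i c, ε i * f i c = f i c := fun i c => e.injective (by
    rw [map_mul, heε, hef]
    funext k
    rw [hεmul]
    by_cases hk : k = i
    · rw [if_pos hk]
    · rw [if_neg hk, Pi.single_eq_of_ne hk])
  let κ : ∀ i, Matrix (Fin (d i)) (Fin (d i)) (D i) →ₗ[ℝ] Matrix (Fin (d i)) (Fin (d i)) (D i) := fun i =>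
    { toFun := fun c => e (ι (f i c)) i
      map_add' := fun c c' => by simp only [f, Pi.single_add, map_add, Pi.add_apply]
      map_smul' := fun r c => by simp only [f, Pi.single_smul, map_smul, Pi.smul_apply, RingHom.id_apply] }
  have hκ : ∀ i c, κ i c = e (ι (f i c)) i := fun i c => rfl
  have hιf : ∀ i c, e (ι (f i c)) = Pi.single i (κ i c) := fun i c => by
    funext k
    by_cases hk : k = i
    · subst hk; rw [Pi.single_eq_same]; exact (hκ k c).symm
    · rw [Pi.single_eq_of_ne hk, ← hεf i c, hI.map_mul, hιε, map_mul, heε, hmulε, if_neg hk]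
  have hfκ : ∀ i c, ι (f i c) = f i (κ i c) := fun i c => e.injective (by rw [hιf, hef])
  -- «as an algebra with involution `B` is the direct product»: `e (x*)ᵢ = κᵢ (e x)ᵢ`
  have hcompat : ∀ (x : B) (i : Fin n), e (ι x) i = κ i (e x i) := fun x i => by
    have h1 : ε i * x = f i (e x i) := e.injective (by
      rw [map_mul, heε, hef]
      funext k
      rw [hεmul]
      by_cases hk : k = i
      · subst hk; rw [if_pos rfl, Pi.single_eq_same]
      · rw [if_neg hk, Pi.single_eq_of_ne hk])
    calc e (ι x) i = (e (ι x) * u i) i := by rw [hmulε, if_pos rfl]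
      _ = e (ι x * ι (ε i)) i := by rw [map_mul, hιε, heε]
      _ = e (ι (ε i * x)) i := by rw [hI.map_mul]
      _ = κ i (e x i) := by rw [h1, hκ]
  -- `κᵢ` is an involution
  have hκinv : ∀ i, IsInvolution ℝ (Matrix (Fin (d i)) (Fin (d i)) (D i)) (κ i) := fun i =>
    ⟨fun c c' => by rw [hκ, hκ, hκ, hfmul, hI.map_mul, map_mul, Pi.mul_apply],
     fun c => by rw [hκ i (κ i c), ← hfκ, hI.apply_apply, hef, Pi.single_eq_same]⟩
  -- «positive on them»: `tr_{Cᵢ/ℝ}(a) = tr_{B/ℝ}(fᵢ a)`, left multiplication by `fᵢ a` living on the factor `fᵢ(Cᵢ)`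
  have htr : ∀ (i) (a : Matrix (Fin (d i)) (Fin (d i)) (D i)),
      leftMulTrace ℝ (Matrix (Fin (d i)) (Fin (d i)) (D i)) a = leftMulTrace ℝ B (f i a) := by
    intro i a
    let fl : Matrix (Fin (d i)) (Fin (d i)) (D i) →ₗ[ℝ] B :=
      e.symm.toLinearEquiv.toLinearMap ∘ₗ LinearMap.single ℝ (fun j => Matrix (Fin (d j)) (Fin (d j)) (D j)) i
    have hfl : ∀ c, fl c = f i c := fun c => rfl
    have hinj : Function.Injective fl := fun c c' h => by
      have := congrArg (fun y => e y i) h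
      simpa [hfl, hef] using this
    let q := LinearEquiv.ofInjective fl hinj
    have hmaps : ∀ b : B, Algebra.lmul ℝ B (f i a) b ∈ LinearMap.range fl := fun b => by
      refine ⟨a * e b i, ?_⟩
      rw [hfl]
      show f i (a * e b i) = f i a * b
      apply e.injective
      rw [hef, map_mul, hef]
      funext k
      rw [Pi.mul_apply]
      by_cases hk : k = i
      · subst hk; rw [Pi.single_eq_same, Pi.single_eq_same]
      · rw [Pi.single_eq_of_ne hk, Pi.single_eq_of_ne hk, zero_mul]
    rw [leftMulTrace_apply, leftMulTrace_apply,
      ← LinearMap.trace_restrict_eq_of_forall_mem (LinearMap.range fl) (Algebra.lmul ℝ B (f i a)) hmaps,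
      ← LinearMap.trace_conj' (Algebra.lmul ℝ (Matrix (Fin (d i)) (Fin (d i)) (D i)) a) q]
    congr 1
    refine LinearMap.ext fun y => Subtype.ext ?_
    obtain ⟨c, hc⟩ : ∃ c, fl c = (y : B) := y.2
    have hqs : q.symm y = c := by
      rw [LinearEquiv.symm_apply_eq]
      exact Subtype.ext (by rw [LinearEquiv.ofInjective_apply]; exact hc.symm)
    rw [LinearEquiv.conj_apply_apply, LinearMap.coe_restrict_apply, hqs, LinearEquiv.ofInjective_apply, hfl, ← hc, hfl]
    show f i (a * c) = f i a * f i c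
    exact hfmul i a c
  have hκpos : ∀ i, IsPositiveInvolution (Matrix (Fin (d i)) (Fin (d i)) (D i)) (κ i) := fun i =>
    { toIsInvolution := hκinv i
      trace_mul_self_pos := fun c hc => by
        rw [htr, hfmul, ← hfκ]
        refine hP.trace_mul_self_pos _ fun h0 => hc ?_
        have := congrArg (fun y => e y i) h0
        simpa [hef] using this }
  refine ⟨n, fun i => Matrix (Fin (d i)) (Fin (d i)) (D i), fun i => inferInstance, fun i => inferInstance, κ, e,
    fun i => ?_, hκpos, hcompat⟩
  haveI := hd i
  infer_instance

end Literature.NumberTheory.Kottwitz1992.Involutions
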